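import Mathlib.Analysis.SpecialFunctions.Log.Base
import Mathlib.Analysis.SpecialFunctions.Pow.Real
import Mathlib.Algebra.Order.BigOperators.Group.Finset
import HarnessLib

/-!
# The quantum accuracy threshold theorem for concatenated distance-3 codes
# (Aliferis–Gottesman–Preskill 2006): the quantitative skeleton

Topic `Literature/InformationTheory/QuantumCodes` (venture QEC, LADDER-QEC rungs Q3/Q5, PARTITION
row 09). HONEST FRAMING. The threshold theorem enters the ladder as a CITED result: its constants
are asymptotic and certify nothing about any specific `[[n,k,d]]`. What a `def … : Prop` rendering
of Theorems 1–3 would have to quantify over — noisy quantum circuits, locations, (extended)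
rectangles, level-`k` ideal decoders, "the `k`-Rec contained in a good `k`-exRec is correct"
(exRec-Cor), the stochastic independence of independent bad exRecs (§5.3) — is a formal apparatus
the tree does not have (the tree's `NoisyCircuit`/`depolarizeWire` of
`Literature/Barriers/QuantumAdvantage/NoiseThresholdUpperBounds.lean` is the Kempe–Regev–Unger–de
Wolf model, a different one; not merged here). Typing only the headline "`ε < 2.73 × 10⁻⁵ ⇒ polylog
simulation`" without that model would be vacuous (qec-lit-2 LIT2-REGISTER §G3). So this file does
NOT mint a vacuous named fact. It PROVES, once and for all, the model-independent quantitative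
skeleton of the paper — the part every threshold proof by concatenation re-uses — with the two
semantic inputs displayed as explicit hypotheses of the theorems (column word PROVED), and records
the printed constant of Theorem 3 as CLAIM data (computer-assisted malignant-pair count, not re-run):

* **Lemma 2, "bad exRecs are rare"** (§3.1, eqs. (pbad-level1)–(p-bad-bound)): if the badness
  probabilities satisfy `ε^{(0)} = ε` and `ε^{(k)} ≤ ε₀⁻¹ (ε^{(k-1)})²` (`ε₀⁻¹ = A` = number of pairs of
  locations in the largest 1-exRec), then `ε^{(k)} ≤ ε₀ (ε/ε₀)^{2^k}` — `levelBound`,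
  `le_levelBound_of_sq_recursion`.
* **Theorem 2's refinement** (§6.3, eqs. (malignant-recursion)–(better-threshold)): if
  `ε^{(k)} ≤ A (ε^{(k-1)})² + B (ε^{(k-1)})³` (`A` malignant pairs, `B` triples) and `ε ≤ ε₀ = 1/A'`
  with `A' ≥ A + B/A'`, then `ε^{(k)} ≤ A' (ε^{(k-1)})²` and again `ε^{(k)} ≤ ε₀ (ε/ε₀)^{2^k}` —
  `le_levelBound_of_cubic_recursion`.
* **Eqs. (19)–(20)** (§4): if the actual output distribution is the mixture
  `(1 - P_fail) p^{ideal} + P_fail p^{fail}`, its `L¹` distance to `p^{ideal}` is `≤ 2 P_fail` —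
  `l1Dist_mixture_le`.
* **Eq. (21)** (§4): `2^k ≥ log(2ε₀L/δ)/log(ε₀/ε)` forces `2 ε₀ L (ε/ε₀)^{2^k} ≤ δ` —
  `error_le_of_levelCount_le`; and such a `k` exists with `2^k ≤ 2 max(1, log(2ε₀L/δ)/log(ε₀/ε))`
  — `exists_level`. Together: **Theorem 1, quantitative form** (`theorem1_skeleton`): given the
  per-level failure bound `P_fail^{(k)} ≤ L ε^{(k)}` (eq. (18): Lemma 2 + union bound over the `L`
  `k`-exRecs — the INDEPENDENCE input) and the error bound `δ^{(k)} ≤ 2 P_fail^{(k)}` (Lemma 4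
  "good circuits match ideal answers" — the exRec-Cor input), some level `k` with
  `2^k ≤ 2 max(1, log(2ε₀L/δ)/log(ε₀/ε))` achieves error `≤ δ`; by self-similarity a `k`-Rec has
  `≤ ℓ^k = (2^k)^{log₂ ℓ}` locations and depth `≤ d^k`, which is the printed
  `L* = O(L (log L)^{log₂ ℓ})`, `D* = O(D (log L)^{log₂ d})`.
* **Theorem 3's constant** `ε₀ = 2.73 × 10⁻⁵` for Steane's `[[7,1,3]]` code (§8.3; `A_CNOT`
  malignant pairs counted "entirely combinatorial[ly] … [by] a computer program", §8.2) is the CLAIM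
  datum `steaneThresholdAGP06`; the naive all-pairs value `(575 choose 2)⁻¹ ≈ 6.06 × 10⁻⁶` is
  `steaneNaiveThresholdAGP06` (also CLAIM: the location count `575` is printed data).

The printed hypotheses that ride with any use (AGP06 §4 after Thm 1, §8.3, §12): classical
computation reliable (or the output kept encoded); inputs prepared in known standard states;
measurement as fast as a gate; two-qubit gates between ANY pair of qubits (non-local); no leakage;
fresh ancillas; parallel gate execution; independent (adversarial) stochastic faults — the
depolarizing value `ε^{(1)}_{0,depol} ≈ 9.376 × 10⁻⁵` "is not a rigorous lower bound on the accuracy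
threshold for depolarizing noise" (§8.3).

Deliberately NOT here: the exRec/rectangle formalism and Lemmas 3–4 themselves (a modelling item
for wave 1+; when it lands, Theorems 1–3 become `def … : Prop` facts over it whose arithmetic is
already discharged by this file); Aharonov–Ben-Or / Kitaev / Knill–Laflamme–Zurek versions;
threshold UPPER bounds (in the tree: `NoiseThresholdUpperBounds.lean`); any Monte Carlo number.

## References (read)

* [AliferisGottesmanPreskill2006] P. Aliferis, D. Gottesman, J. Preskill, *Quantum accuracy
  threshold for concatenated distance-3 codes*, Quantum Inf. Comput. 6 (2006) 97–165,
  arXiv:quant-ph/0504218 (held `paper:arxiv-quant-ph_0504218`): §3.1 (Def. goodness/badness,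
  eq. (pbad-level1), (p-bad-bound), Lemma 2), §3.2 (correctness, exRec-Cor, Lemma 3), §4 (eqs.
  (18)–(21), Lemma 4, Theorem 1 and the paragraph after it), §6.3 (eqs. (malignant-recursion)–
  (better-threshold), Theorem 2), §8.3 (Theorem 3, `ε₀ = 2.73 × 10⁻⁵`; `(575 choose 2)⁻¹`), §12.
-/

namespace Literature.InformationTheory.QuantumCodes

open Finset Real

namespace AGP06

/-! ### Lemma 2: bad extended rectangles are rare -/

/-- The level-`k` badness bound `ε₀ (ε/ε₀)^{2^k}` of a recursive simulation with threshold
estimate `ε₀` at physical fault rate `ε` ("for `ε < ε₀`, the probability of badness declines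
double-exponentially with `k`"). [cite: AliferisGottesmanPreskill2006, Lemma 2] -/
noncomputable def levelBound (ε₀ ε : ℝ) (k : ℕ) : ℝ :=
  ε₀ * (ε / ε₀) ^ 2 ^ k

/-- At level `0` the bound is the physical rate: `ε₀ (ε/ε₀)^1 = ε`.
[cite: AliferisGottesmanPreskill2006, Lemma 2] -/
theorem levelBound_zero {ε₀ : ℝ} (hε₀ : ε₀ ≠ 0) (ε : ℝ) : levelBound ε₀ ε 0 = ε := by
  simp [levelBound, mul_div_cancel₀ _ hε₀]

/-- The bound obeys the squaring recursion with equality: `ε₀ (ε/ε₀)^{2^{k+1}} = ε₀⁻¹ (ε₀ (ε/ε₀)^{2^k})²`.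
[cite: AliferisGottesmanPreskill2006, §3.1 eq. (p-bad-recursion)] -/
theorem levelBound_succ {ε₀ : ℝ} (hε₀ : ε₀ ≠ 0) (ε : ℝ) (k : ℕ) :
    levelBound ε₀ ε (k + 1) = ε₀⁻¹ * levelBound ε₀ ε k ^ 2 := by
  simp only [levelBound, pow_succ, pow_mul]
  field_simp

/-- Below threshold the level bounds never exceed `ε₀`: `ε ≤ ε₀ ⇒ ε₀ (ε/ε₀)^{2^k} ≤ ε₀`.
[cite: AliferisGottesmanPreskill2006, Lemma 2] -/
theorem levelBound_le_self {ε₀ ε : ℝ} (hε₀ : 0 < ε₀) (hε : 0 ≤ ε) (hεε₀ : ε ≤ ε₀) (k : ℕ) :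
    levelBound ε₀ ε k ≤ ε₀ := by
  have h1 : ε / ε₀ ≤ 1 := (div_le_one hε₀).2 hεε₀
  have h0 : 0 ≤ ε / ε₀ := div_nonneg hε hε₀.le
  calc levelBound ε₀ ε k = ε₀ * (ε / ε₀) ^ 2 ^ k := rfl
    _ ≤ ε₀ * 1 := by gcongr; exact pow_le_one₀ h0 h1
    _ = ε₀ := mul_one _

/-- **Lemma 2 (bad exRecs are rare).** If the probability `x k` that a `k`-exRec is bad satisfies
`x 0 ≤ ε` (a bad 0-exRec is a faulty location) and `x (k+1) ≤ ε₀⁻¹ (x k)²` ("`ε^{(k)} ≤ A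
(ε^{(k-1)})²`", `A = ε₀⁻¹` the number of pairs of locations in the largest 1-exRec, because a bad
`k`-exRec contains two independent bad `(k-1)`-exRecs, which are independent events), then
`x k ≤ ε₀ (ε/ε₀)^{2^k}`. [cite: AliferisGottesmanPreskill2006, Lemma 2] -/
theorem le_levelBound_of_sq_recursion {x : ℕ → ℝ} {ε₀ ε : ℝ} (hε₀ : 0 < ε₀)
    (hx : ∀ k, 0 ≤ x k) (h0 : x 0 ≤ ε) (hrec : ∀ k, x (k + 1) ≤ ε₀⁻¹ * x k ^ 2) (k : ℕ) :
    x k ≤ levelBound ε₀ ε k := by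
  induction k with
  | zero => rwa [levelBound_zero hε₀.ne']
  | succ k ih =>
    calc x (k + 1) ≤ ε₀⁻¹ * x k ^ 2 := hrec k
      _ ≤ ε₀⁻¹ * levelBound ε₀ ε k ^ 2 := by
          gcongr
          exact hx k
      _ = levelBound ε₀ ε (k + 1) := (levelBound_succ hε₀.ne' ε k).symm

/-! ### Theorem 2: the refined recursion with malignant pairs and triples -/

/-- **The refined recursion** behind Theorem 2: if `x (k+1) ≤ A (x k)² + B (x k)³` (`A` = number of
malignant pairs, `B` = number of triples of locations in the 1-exRec), `x 0 ≤ ε ≤ ε₀ = 1/A'` where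
`A' ≥ A + B/A'` (the printed choice is equality, `A' = ½ A (1 + √(1 + 4B/A²))`), then
`x (k+1) ≤ A' (x k)²` at every level and hence `x k ≤ ε₀ (ε/ε₀)^{2^k}`.
[cite: AliferisGottesmanPreskill2006, Thm 2 (§6.3 eqs. (malignant-recursion)–(better-threshold))] -/
theorem le_levelBound_of_cubic_recursion {x : ℕ → ℝ} {A B A' ε : ℝ} (hA' : 0 < A') (hB : 0 ≤ B)
    (hAA' : A + B / A' ≤ A') (hx : ∀ k, 0 ≤ x k) (h0 : x 0 ≤ ε) (hε : ε ≤ A'⁻¹)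
    (hrec : ∀ k, x (k + 1) ≤ A * x k ^ 2 + B * x k ^ 3) (k : ℕ) :
    x k ≤ levelBound A'⁻¹ ε k := by
  have hε0 : 0 ≤ ε := (hx 0).trans h0
  induction k with
  | zero => rwa [levelBound_zero (inv_ne_zero hA'.ne')]
  | succ k ih =>
    -- below `1/A'` the cubic recursion is dominated by the squaring recursion with constant `A'`
    have hxk : x k ≤ A'⁻¹ := ih.trans (levelBound_le_self (inv_pos.2 hA') hε0 hε k)
    have hAB : A + B * x k ≤ A' := by
      calc A + B * x k ≤ A + B * A'⁻¹ := by gcongr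
        _ = A + B / A' := by rw [div_eq_mul_inv]
        _ ≤ A' := hAA'
    have hstep : x (k + 1) ≤ A' * x k ^ 2 := by
      calc x (k + 1) ≤ A * x k ^ 2 + B * x k ^ 3 := hrec k
        _ = (A + B * x k) * x k ^ 2 := by ring
        _ ≤ A' * x k ^ 2 := by gcongr
    calc x (k + 1) ≤ A' * x k ^ 2 := hstep
      _ ≤ A' * levelBound A'⁻¹ ε k ^ 2 := by
          gcongr
          exact hx k
      _ = levelBound A'⁻¹ ε (k + 1) := by
          rw [levelBound_succ (inv_ne_zero hA'.ne'), inv_inv]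

/-! ### Eqs. (19)–(20): the error of a computation that fails with probability `P_fail` -/

/-- **Eqs. (19)–(20).** If the actual output distribution is the mixture
`p^{actual} = (1 - P) p^{ideal} + P p^{fail}` of the ideal distribution and an arbitrary
distribution ("by averaging over the fault locations"), then its `L¹` error
`δ = Σᵢ |p^{actual}_i - p^{ideal}_i|` is at most `2P` ("since the maximal `L¹` distance between any
two probability distributions is 2"). [cite: AliferisGottesmanPreskill2006, §4 eqs. (19)–(20)] -/
theorem l1Dist_mixture_le {ι : Type*} [Fintype ι] (p q : ι → ℝ) (hp : ∀ i, 0 ≤ p i)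
    (hq : ∀ i, 0 ≤ q i) (hp1 : ∑ i, p i = 1) (hq1 : ∑ i, q i = 1) {P : ℝ} (hP : 0 ≤ P) :
    ∑ i, |((1 - P) * p i + P * q i) - p i| ≤ 2 * P := by
  have h : ∀ i, ((1 - P) * p i + P * q i) - p i = P * (q i - p i) := fun i => by ring
  simp_rw [h, abs_mul, abs_of_nonneg hP, ← Finset.mul_sum]
  calc P * ∑ i, |q i - p i| ≤ P * ∑ i, (q i + p i) := by
        gcongr with i
        exact abs_sub_le_iff.2 ⟨by linarith [hp i, hq i], by linarith [hp i, hq i]⟩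
    _ = 2 * P := by rw [Finset.sum_add_distrib, hq1, hp1]; ring

/-! ### Eq. (21): how many levels of concatenation suffice -/

/-- The printed level count `log(2ε₀L/δ)/log(ε₀/ε)`: error `δ` is reached as soon as `2^k` exceeds
it. [cite: AliferisGottesmanPreskill2006, §4 eq. (21)] -/
noncomputable def levelCount (ε₀ ε L δ : ℝ) : ℝ :=
  Real.log (2 * ε₀ * L / δ) / Real.log (ε₀ / ε)

/-- **Eq. (21).** If `2^k ≥ log(2ε₀L/δ)/log(ε₀/ε)` (with `0 < ε < ε₀`, `L, δ > 0`), then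
`2 ε₀ L (ε/ε₀)^{2^k} ≤ δ` ("error `δ` or better can be achieved by choosing …").
[cite: AliferisGottesmanPreskill2006, §4 eq. (21)] -/
theorem error_le_of_levelCount_le {ε₀ ε L δ : ℝ} {k : ℕ} (hε : 0 < ε) (hεε₀ : ε < ε₀)
    (hL : 0 < L) (hδ : 0 < δ) (hk : levelCount ε₀ ε L δ ≤ (2 : ℝ) ^ k) :
    2 * ε₀ * L * (ε / ε₀) ^ 2 ^ k ≤ δ := by
  have hε₀ : 0 < ε₀ := hε.trans hεε₀
  have hlog : 0 < Real.log (ε₀ / ε) := Real.log_pos ((one_lt_div hε).2 hεε₀)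
  have hX : 0 < 2 * ε₀ * L / δ := by positivity
  have hr : 0 < ε / ε₀ := div_pos hε hε₀
  -- `log(2ε₀L/δ) ≤ 2^k · log(ε₀/ε)`
  have h1 : Real.log (2 * ε₀ * L / δ) ≤ (2 : ℝ) ^ k * Real.log (ε₀ / ε) :=
    (div_le_iff₀ hlog).1 hk
  -- hence `log((2ε₀L/δ) · (ε/ε₀)^{2^k}) ≤ 0`
  have h2 : Real.log (2 * ε₀ * L / δ * (ε / ε₀) ^ 2 ^ k) ≤ 0 := by
    rw [Real.log_mul hX.ne' (pow_pos hr _).ne', Real.log_pow, Real.log_div hε.ne' hε₀.ne']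
    rw [Real.log_div hε₀.ne' hε.ne'] at h1
    push_cast
    linarith
  have h3 : 2 * ε₀ * L / δ * (ε / ε₀) ^ 2 ^ k ≤ 1 :=
    (Real.log_nonpos_iff (by positivity)).1 h2
  rw [div_mul_eq_mul_div, div_le_one hδ] at h3
  exact h3

/-- **A level achieving eq. (21) exists**, with `2^k ≤ 2 max(1, log(2ε₀L/δ)/log(ε₀/ε))` (take
`k = ⌈log₂ max(1, ·)⌉`); through `ℓ^k = (2^k)^{log₂ ℓ}` this is the printed overhead
`L* = O(L (log L)^{log₂ ℓ})`, `D* = O(D (log L)^{log₂ d})`. [cite: AliferisGottesmanPreskill2006, Thm 1 (§4, from eq. (21))] -/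
theorem exists_level (M : ℝ) : ∃ k : ℕ, M ≤ (2 : ℝ) ^ k ∧ (2 : ℝ) ^ k ≤ 2 * max 1 M := by
  set y : ℝ := Real.logb 2 (max 1 M) with hy
  have hmax : 1 ≤ max 1 M := le_max_left _ _
  have hmax0 : 0 < max 1 M := lt_of_lt_of_le one_pos hmax
  have hy0 : 0 ≤ y := Real.logb_nonneg one_lt_two hmax
  refine ⟨⌈y⌉₊, ?_, ?_⟩
  · calc M ≤ max 1 M := le_max_right _ _
      _ = (2 : ℝ) ^ y := (Real.rpow_logb two_pos (by norm_num) hmax0).symm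
      _ ≤ (2 : ℝ) ^ (⌈y⌉₊ : ℝ) := Real.rpow_le_rpow_of_exponent_le one_le_two (Nat.le_ceil y)
      _ = (2 : ℝ) ^ ⌈y⌉₊ := Real.rpow_natCast 2 ⌈y⌉₊
  · calc (2 : ℝ) ^ ⌈y⌉₊ = (2 : ℝ) ^ (⌈y⌉₊ : ℝ) := (Real.rpow_natCast 2 ⌈y⌉₊).symm
      _ ≤ (2 : ℝ) ^ (y + 1) :=
          Real.rpow_le_rpow_of_exponent_le one_le_two (Nat.ceil_lt_add_one hy0).le
      _ = 2 * (2 : ℝ) ^ y := by rw [Real.rpow_add two_pos, Real.rpow_one, mul_comm]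
      _ = 2 * max 1 M := by rw [Real.rpow_logb two_pos (by norm_num) hmax0]

/-! ### Theorem 1: the quantitative skeleton -/

/-- **Theorem 1 (quantum accuracy threshold for independent stochastic noise), quantitative
skeleton.** Printed: "Suppose that fault-tolerant gadgets can be constructed such that all 1-exRecs
obey the property exRec-Cor, and such that `ℓ` is the maximal number of locations in a 1-Rec, `d` is
the maximal depth of a 1-Rec, and `ε₀⁻¹` is the maximal number of pairs of locations in a 1-exRec.
Suppose that independent stochastic faults occur with probability `ε < ε₀` at each location in a
noisy quantum circuit. Then for any fixed `δ`, any ideal circuit with `L` locations and depth `D`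
can be simulated with error `δ` or better by a noisy circuit with `L* = O(L (log L)^{log₂ ℓ})`
locations and depth `D* = O(D (log L)^{log₂ d})`." Typed (what the paper derives in §4 from its two
circuit-level inputs, here explicit hypotheses on the level-`k` simulation's failure probability
`Pfail k` and output error `err k`): (eq. (18), from Lemma 2 and the INDEPENDENCE of independent bad
exRecs) `Pfail k ≤ L · ε₀ (ε/ε₀)^{2^k}`; (eqs. (19)–(20), from Lemma 4 = exRec-Cor via Lemma 3)
`err k ≤ 2 Pfail k`. Conclusion: some level `k` with `2^k ≤ 2 max(1, log(2ε₀L/δ)/log(ε₀/ε))` has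
`err k ≤ δ` (the simulating circuit then has `≤ L ℓ^k = L (2^k)^{log₂ ℓ}` locations and depth
`≤ D d^k` by self-similarity, §4). [cite: AliferisGottesmanPreskill2006, Thm 1] -/
theorem theorem1_skeleton {ε₀ ε δ : ℝ} {L : ℕ} {Pfail err : ℕ → ℝ} (hε : 0 < ε) (hεε₀ : ε < ε₀)
    (hL : 0 < L) (hδ : 0 < δ) (hfail : ∀ k, Pfail k ≤ L * levelBound ε₀ ε k)
    (herr : ∀ k, err k ≤ 2 * Pfail k) :
    ∃ k : ℕ, err k ≤ δ ∧ (2 : ℝ) ^ k ≤ 2 * max 1 (levelCount ε₀ ε L δ) := by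
  obtain ⟨k, hk, hk'⟩ := exists_level (levelCount ε₀ ε L δ)
  refine ⟨k, ?_, hk'⟩
  have hL' : (0 : ℝ) < L := by exact_mod_cast hL
  calc err k ≤ 2 * Pfail k := herr k
    _ ≤ 2 * (L * levelBound ε₀ ε k) := by linarith [hfail k]
    _ = 2 * ε₀ * L * (ε / ε₀) ^ 2 ^ k := by simp only [levelBound]; ring
    _ ≤ δ := error_le_of_levelCount_le hε hεε₀ hL' hδ hk

/-! ### Theorem 3: the printed constant (CLAIM data) -/

/-- **Theorem 3's constant** `ε₀ = 2.73 × 10⁻⁵`: "Suppose that independent stochastic faults occur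
with probability `ε` at each location in a noisy quantum circuit. Then for any fixed `δ`, any ideal
circuit with `L` locations can be simulated with error `δ` or better by a noisy circuit with
`L* = L (polylog L)` locations, provided that `ε < ε₀ = 2.73 × 10⁻⁵`" (Steane's `[[7,1,3]]` code;
`ε₀ = (A''_CNOT)⁻¹`, `A''_CNOT ≈ 36,511`, from the malignant-pair count `A_CNOT` obtained by "a
computer program"). CLAIM as printed (computer-assisted count, not re-run here); a datum, not a
theorem. [cite: AliferisGottesmanPreskill2006, Thm 3] -/
noncomputable def steaneThresholdAGP06 : ℝ := 2.73e-5

/-- The naive all-pairs estimate the paper compares with: "if we merely counted the number of pairs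
of locations in the 1-exRec and used Theorem 1, we would estimate `ε₀ = (575 choose 2)⁻¹ ≈ 6.06 ×
10⁻⁶`" (`575` locations in the CNOT 1-exRec). CLAIM as printed (the location count is printed data).
[cite: AliferisGottesmanPreskill2006, §8.3 (after Thm 3)] -/
noncomputable def steaneNaiveThresholdAGP06 : ℝ := ((Nat.choose 575 2 : ℕ) : ℝ)⁻¹

/-- The two printed numbers are consistent with "improved the lower bound … by a factor of about
4.5": `(575 choose 2)⁻¹ < 2.73 × 10⁻⁵` (indeed `165025 · 2.73 × 10⁻⁵ ≈ 4.5`).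
[cite: AliferisGottesmanPreskill2006, §8.3 (after Thm 3)] -/
theorem steaneNaiveThreshold_lt_steaneThreshold :
    steaneNaiveThresholdAGP06 < steaneThresholdAGP06 := by
  rw [steaneNaiveThresholdAGP06, steaneThresholdAGP06, Nat.choose_two_right]
  norm_num

end AGP06

end Literature.InformationTheory.QuantumCodes
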